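import Summits.CriticalPhenomena.Ising3DConformalLimit.Theorems.PrecisionLaplacianDirectCorrelationStableTailPickInversionAux14
import Summits.CriticalPhenomena.Ising3DConformalLimit.Theorems.PrecisionLaplacianDirectCorrelationStableTailSlabSpectralRepresentation

/-!
# Diagonal line holomorphy, auxiliary file 2: the moment criterion on `[-1, 1]`, the centred
# binomial (de la Vallée-Poussin) kernel, and separated bumps

Helper file for the sub-stub `stub_slabModeExpDecay_auxDiagLineHol` (brick of `stub_slabModeExpDecay`)
of line `self-energy-pick-inversion`, crux `PrecisionLaplacian.DirectCorrelationStableTail`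
(stmt-CriticalPhenomena-4799). Pure theorem file; pure analysis.

* `exists_measure_Icc_neg_one_of_momentLimit` (registered sub-goal
  `stub_slabModeExpDecay_auxDiagLineHol3`): the two-sided version of the moment criterion
  `exists_hausdorffMeasure_of_momentLimit` of file `…SlabSpectralRepresentation`: if finite positive
  measures `ν_j` on `ℝ` have even moments `∫ x^{2n} dν_j ≤ M` for `n ≤ j` and `∫ xⁿ dν_j → u(n)` for
  every `n`, then `u(n) = ∫ xⁿ dμ` for a finite positive measure `μ` on `[-1, 1]` (restrict to `[-2, 2]`,
  tails `≤ M 2^{n-2j}`, weak cluster point, and `c^{2n} μ(|x| > c) ≤ u(2n) ≤ M` kills `|x| > 1`);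
* `centredBinomial_cos_eq`, `centredBinomial_sin_eq` : with `b_N(y) = ∏_j C(2N, y_j + N)` on
  `{-N,…,N}²`, `∑_y b_N(y) cos(ξ·y) = ∏_j (2 + 2 cos ξ_j)^N` and `∑_y b_N(y) sin(ξ·y) = 0`
  (`e^{-iNt}(1 + e^{it})^{2N} = (2 + 2cos t)^N`);
* `prod_two_add_two_cos_mul_le`, `tendsto_separatedBumps` : the product of the two bumps centred at
  `±κ₀`, `∏_j (2+2cos(k_j+κ₀ⱼ))^N (2+2cos(k_j-κ₀ⱼ))^N = 16^N ∏_j (cos k_j + cos κ₀ⱼ)^{2N}`, is at most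
  `16^N (1 + cos δ)^{2N} 4^N` when `|cos κ₀_{j₀}| ≤ cos δ`, hence negligible against the normalisation
  `16^N I_{2N}²` of one squared bump (`tendsto_vp_far_sup` of file `…PickInversionAux13`).

References: Aizenman–Duminil-Copin (2021), App. §8.3; Katznelson, Ch. I §2 (de la Vallée-Poussin).
-/

noncomputable section

namespace Summit.CriticalPhenomena.Ising3DConformalLimit.Cruxes.DirectCorrelationStableTail.SelfEnergyPickInversion

open MeasureTheory Filter Topology Set Real
open scoped BigOperators
open Literature.Probability.LatticeModels

/-! ### The moment criterion on `[-1, 1]` -/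

/-- Truncated powers as bounded continuous functions on `[-2, 2]`: some `g ∈ C_b(ℝ)` agrees with
`xⁿ` on `[-2, 2]` (namely `(max (-2) (min x 2))ⁿ`). [folklore] -/
theorem exists_bcf_eq_pow_Icc_neg_two (n : ℕ) : ∃ g : BoundedContinuousFunction ℝ ℝ,
    ∀ x ∈ Set.Icc (-2 : ℝ) 2, g x = x ^ n := by
  refine ⟨BoundedContinuousFunction.ofNormedAddCommGroup (fun x => (max (-2) (min x 2)) ^ n)
    ((continuous_const.max (continuous_id.min continuous_const)).pow n) (2 ^ n) fun x => ?_, fun x hx => ?_⟩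
  · have h0 : -2 ≤ max (-2) (min x 2) := le_max_left _ _
    have h2 : max (-2) (min x 2) ≤ 2 := max_le (by norm_num) (min_le_right _ _)
    rw [Real.norm_eq_abs, abs_pow]
    exact pow_le_pow_left₀ (abs_nonneg _) (abs_le.2 ⟨by linarith, h2⟩) n
  · simp only [BoundedContinuousFunction.coe_ofNormedAddCommGroup]
    rw [min_eq_left hx.2, max_eq_right hx.1]

/-- **The moment criterion on `[-1, 1]`.** If finite positive measures `ν_j` on `ℝ` with all moments
finite have even moments `∫ x^{2n} dν_j ≤ M` for `n ≤ j`, and `∫ xⁿ dν_j → u(n)` for every `n`, then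
`u(n) = ∫ xⁿ dμ` for a finite positive measure `μ` on `[-1, 1]`. [folklore] -/
theorem exists_measure_Icc_neg_one_of_momentLimit (u : ℕ → ℝ) (ν : ℕ → Measure ℝ)
    (hfin : ∀ j, IsFiniteMeasure (ν j)) {M : ℝ}
    (hint : ∀ j n, Integrable (fun x : ℝ => x ^ n) (ν j))
    (hle : ∀ j n, n ≤ j → ∫ x, x ^ (2 * n) ∂(ν j) ≤ M)
    (hlim : ∀ n, Tendsto (fun j => ∫ x, x ^ n ∂(ν j)) atTop (𝓝 (u n))) :
    ∃ μ : Measure ℝ, IsFiniteMeasure μ ∧ μ (Set.Icc (-1 : ℝ) 1)ᶜ = 0 ∧ ∀ n : ℕ, u n = ∫ t, t ^ n ∂μ := by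
  -- adapted from `exists_hausdorffMeasure_of_momentLimit` (file `…SlabSpectralRepresentation`)
  classical
  set K : Set ℝ := Icc (-2) 2 with hKdef
  have hK : IsCompact K := isCompact_Icc
  have hKm : MeasurableSet K := measurableSet_Icc
  have huM : ∀ n, u (2 * n) ≤ M := fun n =>
    le_of_tendsto (hlim (2 * n)) (eventually_atTop.2 ⟨n, fun j hj => hle j n hj⟩)
  have hevpow : ∀ (x : ℝ) (n : ℕ), x ^ (2 * n) = |x| ^ (2 * n) := fun x n => by rw [pow_mul, pow_mul, sq_abs]
  /- Step 1: the truncated moments converge: `∫_K xⁿ dν_j → u(n)` (tail `≤ M 2^{n-2j}`). -/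
  have htail : ∀ n j, n ≤ 2 * j → |∫ x in Kᶜ, x ^ n ∂(ν j)| ≤ M * (1 / 2) ^ (2 * j - n) := by
    intro n j hnj
    haveI := hfin j
    have haeK : ∀ᵐ x ∂(ν j).restrict Kᶜ, 2 < |x| := by
      filter_upwards [ae_restrict_mem hKm.compl] with x hx
      simp only [hKdef, mem_compl_iff, mem_Icc, not_and_or, not_le] at hx
      rcases hx with hx | hx
      · rw [abs_of_neg (by linarith)]; linarith
      · rw [abs_of_pos (by linarith)]; exact hx
    have hpt : ∀ x : ℝ, 2 < |x| → |x ^ n| ≤ x ^ (2 * j) * (1 / 2) ^ (2 * j - n) := by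
      intro x hx
      rw [abs_pow, hevpow]
      have h2 : (2 : ℝ) ^ (2 * j - n) ≤ |x| ^ (2 * j - n) := pow_le_pow_left₀ (by norm_num) hx.le _
      have hxj : |x| ^ (2 * j) = |x| ^ n * |x| ^ (2 * j - n) := by rw [← pow_add]; congr 1; omega
      rw [hxj, one_div_pow, mul_one_div, le_div_iff₀ (pow_pos (by norm_num : (0 : ℝ) < 2) _)]
      exact mul_le_mul_of_nonneg_left h2 (pow_nonneg (abs_nonneg x) n)
    calc |∫ x in Kᶜ, x ^ n ∂(ν j)| ≤ ∫ x in Kᶜ, |x ^ n| ∂(ν j) := abs_integral_le_integral_abs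
      _ ≤ ∫ x in Kᶜ, x ^ (2 * j) * (1 / 2) ^ (2 * j - n) ∂(ν j) :=
          integral_mono_ae (hint j n).abs.integrableOn ((hint j (2 * j)).mul_const _).integrableOn
            (haeK.mono fun x hx => hpt x hx)
      _ = (∫ x in Kᶜ, x ^ (2 * j) ∂(ν j)) * (1 / 2) ^ (2 * j - n) := integral_mul_const _ _
      _ ≤ (∫ x, x ^ (2 * j) ∂(ν j)) * (1 / 2) ^ (2 * j - n) := by
          refine mul_le_mul_of_nonneg_right ?_ (pow_nonneg (by norm_num) _)
          exact setIntegral_le_integral (hint j (2 * j))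
            (Eventually.of_forall fun x => by
              show (0 : ℝ) ≤ x ^ (2 * j); rw [hevpow]; exact pow_nonneg (abs_nonneg x) _)
      _ ≤ M * (1 / 2) ^ (2 * j - n) :=
          mul_le_mul_of_nonneg_right (hle j j le_rfl) (pow_nonneg (by norm_num) _)
  have htrunc : ∀ n, Tendsto (fun j => ∫ x in K, x ^ n ∂(ν j)) atTop (𝓝 (u n)) := by
    intro n
    have hsplit : ∀ j, ∫ x in K, x ^ n ∂(ν j) = ∫ x, x ^ n ∂(ν j) - ∫ x in Kᶜ, x ^ n ∂(ν j) := by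
      intro j; rw [← integral_add_compl hKm (hint j n)]; ring
    simp_rw [hsplit]
    rw [← sub_zero (u n)]
    refine (hlim n).sub ?_
    have hgeom : Tendsto (fun j : ℕ => M * (1 / 2 : ℝ) ^ (2 * j - n)) atTop (𝓝 0) := by
      have h2j : Tendsto (fun j : ℕ => 2 * j - n) atTop atTop :=
        tendsto_atTop_atTop.2 fun b => ⟨b + n, fun j hj => by omega⟩
      have h := ((tendsto_pow_atTop_nhds_zero_of_lt_one (by norm_num : (0 : ℝ) ≤ 1 / 2)
        (by norm_num)).comp h2j).const_mul M
      simpa using h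
    rw [tendsto_zero_iff_abs_tendsto_zero]
    exact tendsto_of_tendsto_of_tendsto_of_le_of_le' tendsto_const_nhds hgeom
      (Eventually.of_forall fun j => abs_nonneg _) (eventually_atTop.2 ⟨n, fun j hj => htail n j (by omega)⟩)
  /- Step 2: a weak cluster point `ν̄` of the restrictions to `K`. -/
  let ρ : ℕ → FiniteMeasure ℝ := fun j => ⟨(ν j).restrict K, by haveI := hfin j; infer_instance⟩
  have hρcoe : ∀ j, ((ρ j : FiniteMeasure ℝ) : Measure ℝ) = (ν j).restrict K := fun j => rfl
  set S : Set (FiniteMeasure ℝ) := {μ | μ.mass ≤ M.toNNReal ∧ μ Kᶜ = 0} with hSdef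
  have hS : IsCompact S := isCompact_setOf_finiteMeasure_le_of_isCompact M.toNNReal hK
  have hρS : ∀ j, ρ j ∈ S := by
    intro j
    haveI := hfin j
    constructor
    · have h1 : (ν j) univ ≤ ENNReal.ofReal M := by
        have h := hle j 0 (Nat.zero_le j)
        simp only [mul_zero, pow_zero, integral_const, smul_eq_mul, mul_one] at h
        have : (ν j) univ = ENNReal.ofReal ((ν j).real univ) :=
          (ofReal_measureReal (by finiteness)).symm
        rw [this]
        exact ENNReal.ofReal_le_ofReal h
      have h2 : ((ρ j : FiniteMeasure ℝ) : Measure ℝ) univ ≤ ENNReal.ofReal M := by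
        rw [hρcoe, Measure.restrict_apply MeasurableSet.univ, univ_inter]
        exact (measure_mono (subset_univ _)).trans h1
      have h3 : ((ρ j).mass : ENNReal) ≤ ((M.toNNReal : NNReal) : ENNReal) := by
        rw [FiniteMeasure.ennreal_mass]; exact h2
      exact_mod_cast h3
    · rw [FiniteMeasure.null_iff_toMeasure_null, hρcoe, Measure.restrict_apply hKm.compl,
        compl_inter_self, measure_empty]
  have hleS : (atTop : Filter ℕ).map ρ ≤ 𝓟 S := le_principal_iff.2 (mem_map.2 (univ_mem' fun j => hρS j))
  obtain ⟨νbar, hνbarS, hclu⟩ := hS.exists_clusterPt hleS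
  have hclu' : MapClusterPt νbar atTop ρ := hclu
  set μb : Measure ℝ := (νbar : Measure ℝ) with hμb
  have hμbK : μb Kᶜ = 0 := (FiniteMeasure.null_iff_toMeasure_null νbar Kᶜ).1 hνbarS.2
  have haeK : ∀ᵐ x ∂μb, x ∈ K := (measure_eq_zero_iff_ae_notMem.1 hμbK).mono fun x hx => of_not_not hx
  /- Step 3: moments along the cluster point. -/
  have hcluInt : ∀ g : BoundedContinuousFunction ℝ ℝ,
      MapClusterPt (∫ x, g x ∂μb) atTop (fun j => ∫ x, g x ∂(ρ j : Measure ℝ)) := by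
    intro g
    have hcont : Continuous fun μ : FiniteMeasure ℝ => ∫ x, g x ∂(μ : Measure ℝ) :=
      FiniteMeasure.continuous_integral_boundedContinuousFunction g
    exact hclu'.tendsto_comp (hcont.tendsto νbar)
  have hmomK : ∀ n, ∫ x, x ^ n ∂μb = u n := by
    intro n
    obtain ⟨g, hg⟩ := exists_bcf_eq_pow_Icc_neg_two n
    have h1 : ∀ j, ∫ x, g x ∂(ρ j : Measure ℝ) = ∫ x in K, x ^ n ∂(ν j) := fun j => by
      rw [hρcoe]; exact setIntegral_congr_fun hKm fun x hx => hg x hx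
    have h2 : ∫ x, g x ∂μb = u n := by
      refine AxisSpectral.eq_of_mapClusterPt_of_tendsto (hcluInt g) ?_
      simp_rw [h1]
      exact htrunc n
    rw [← h2]
    exact integral_congr_ae (haeK.mono fun x hx => (hg x hx).symm)
  have hintb : ∀ n, Integrable (fun x : ℝ => x ^ n) μb := fun n => by
    obtain ⟨g, hg⟩ := exists_bcf_eq_pow_Icc_neg_two n
    exact (g.integrable μb).congr (haeK.mono fun x hx => hg x hx)
  /- Step 4: no mass on `|x| > 1` (`c^{2n} ν̄(|x| > c) ≤ u(2n) ≤ M` for every `n`). -/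
  have hone_b : μb {x | 1 < |x|} = 0 := by
    have hc : ∀ c : ℝ, 1 < c → μb {x | c < |x|} = 0 := by
      intro c hc
      have hc0 : 0 ≤ c := by linarith
      have hmeas : MeasurableSet {x : ℝ | c < |x|} := measurableSet_lt measurable_const (by fun_prop)
      have hbound : ∀ n : ℕ, μb.real {x | c < |x|} ≤ M * (1 / c ^ 2) ^ n := by
        intro n
        have h1 : (c ^ 2) ^ n * μb.real {x | c < |x|} ≤ M := by
          calc (c ^ 2) ^ n * μb.real {x | c < |x|} = ∫ x, {x | c < |x|}.indicator (fun _ => (c ^ 2) ^ n) x ∂μb := by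
                rw [integral_indicator_const _ hmeas, smul_eq_mul, mul_comm]
            _ ≤ ∫ x, x ^ (2 * n) ∂μb := by
                refine integral_mono_ae ((integrable_const _).indicator hmeas) (hintb (2 * n)) ?_
                refine Eventually.of_forall fun x => ?_
                by_cases hxc : x ∈ {x | c < |x|}
                · rw [indicator_of_mem hxc]
                  show (c ^ 2) ^ n ≤ x ^ (2 * n)
                  rw [hevpow, pow_mul]
                  exact pow_le_pow_left₀ (sq_nonneg c) (by
                    have : c < |x| := hxc
                    nlinarith [abs_nonneg x]) n
                · rw [indicator_of_notMem hxc]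
                  show (0 : ℝ) ≤ x ^ (2 * n)
                  rw [hevpow]
                  exact pow_nonneg (abs_nonneg x) _
            _ = u (2 * n) := hmomK (2 * n)
            _ ≤ M := huM n
        rw [one_div_pow, mul_one_div, le_div_iff₀ (pow_pos (by positivity) n), mul_comm]
        exact h1
      have hlim0 : Tendsto (fun n : ℕ => M * (1 / c ^ 2) ^ n) atTop (𝓝 0) := by
        have hc2 : 1 < c ^ 2 := by nlinarith
        have h := (tendsto_pow_atTop_nhds_zero_of_lt_one (by positivity)
          ((div_lt_one (by positivity)).2 hc2)).const_mul M
        simpa using h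
      have hle0 : μb.real {x | c < |x|} ≤ 0 := ge_of_tendsto hlim0 (Eventually.of_forall hbound)
      exact (measureReal_eq_zero_iff (by finiteness)).1 (le_antisymm hle0 measureReal_nonneg)
    have hcover : {x : ℝ | 1 < |x|} ⊆ ⋃ m : ℕ, {x | 1 + 1 / ((m : ℝ) + 1) < |x|} := by
      intro x hx
      obtain ⟨m, hm⟩ := exists_nat_one_div_lt (sub_pos.2 (show (1 : ℝ) < |x| from hx))
      exact mem_iUnion.2 ⟨m, by show 1 + 1 / ((m : ℝ) + 1) < |x|; linarith⟩
    refine measure_mono_null hcover (measure_iUnion_null fun m => hc _ ?_)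
    have : 0 < 1 / ((m : ℝ) + 1) := by positivity
    linarith
  /- Conclusion. -/
  refine ⟨μb, inferInstance, ?_, fun n => (hmomK n).symm⟩
  refine measure_mono_null (fun x hx => ?_) hone_b
  simp only [mem_compl_iff, mem_Icc, not_and_or, not_le] at hx
  show 1 < |x|
  rcases hx with hx | hx
  · rw [abs_of_neg (by linarith)]; linarith
  · rw [abs_of_pos (by linarith)]; exact hx

/-! ### The centred binomial kernel -/

/-- `∑_{t=-N}^{N} C(2N, t + N) e^{iξt} = (2 + 2cos ξ)^N` (as a complex number):
`e^{-iNξ}(1 + e^{iξ})^{2N} = ((1 + e^{iξ})² e^{-iξ})^N`. [folklore] -/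
theorem sum_Icc_choose_mul_cexp (N : ℕ) (ξ : ℝ) :
    ∑ t ∈ Finset.Icc (-(N : ℤ)) N, ((2 * N).choose (t + N).toNat : ℂ) * Complex.exp ((ξ * t : ℝ) * Complex.I) =
      (((2 + 2 * Real.cos ξ) ^ N : ℝ) : ℂ) := by
  -- reindex `t = m - N`, `m ∈ {0, …, 2N}`
  have himg : (Finset.range (2 * N + 1)).image (fun m : ℕ => (m : ℤ) - N) = Finset.Icc (-(N : ℤ)) N := by
    ext t
    simp only [Finset.mem_image, Finset.mem_range, Finset.mem_Icc]
    constructor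
    · rintro ⟨m, hm, rfl⟩; constructor <;> omega
    · rintro ⟨h0, hN⟩
      exact ⟨(t + N).toNat, by omega, by omega⟩
  rw [← himg, Finset.sum_image (fun m _ m' _ h => by exact_mod_cast (sub_left_inj.mp h))]
  have hterm : ∀ m : ℕ, ((2 * N).choose (((m : ℤ) - N) + N).toNat : ℂ) *
      Complex.exp ((ξ * (((m : ℤ) - N : ℤ) : ℝ) : ℝ) * Complex.I) =
      ((2 * N).choose m : ℂ) * Complex.exp ((m : ℝ) * ξ * Complex.I) * Complex.exp (-(N * ξ) * Complex.I) := by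
    intro m
    rw [show ((m : ℤ) - N) + N = (m : ℤ) by ring, Int.toNat_natCast, mul_assoc, ← Complex.exp_add]
    congr 2
    push_cast; ring
  simp_rw [hterm]
  rw [← Finset.sum_mul, sum_choose_mul_cexp (2 * N) ξ]
  have hsq : (Complex.exp (ξ * Complex.I) + 1) ^ 2 * Complex.exp (-ξ * Complex.I) =
      ((2 + 2 * Real.cos ξ : ℝ) : ℂ) := by
    have h1 : Complex.exp (ξ * Complex.I) * Complex.exp (-ξ * Complex.I) = 1 := by
      rw [← Complex.exp_add]; simp
    have h2 : (2 : ℂ) * Complex.cos (ξ : ℂ) = Complex.exp (ξ * Complex.I) + Complex.exp (-ξ * Complex.I) :=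
      Complex.two_cos _
    push_cast
    rw [h2]
    linear_combination (Complex.exp (ξ * Complex.I) + 2) * h1
  calc (Complex.exp (ξ * Complex.I) + 1) ^ (2 * N) * Complex.exp (-(N * ξ) * Complex.I)
      = ((Complex.exp (ξ * Complex.I) + 1) ^ 2 * Complex.exp (-ξ * Complex.I)) ^ N := by
        rw [mul_pow, pow_mul, ← Complex.exp_nat_mul]
        congr 2; ring
    _ = (((2 + 2 * Real.cos ξ) ^ N : ℝ) : ℂ) := by rw [hsq, Complex.ofReal_pow]

/-- **The centred binomial kernel is a real exponential sum.** With `s_N = {-N,…,N}² ⊂ ℤ²` and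
`b(y) = ∏_j C(2N, y_j + N)`: `∑_{y∈s_N} b(y) e^{iξ·y} = ∏_j (2 + 2cos ξ_j)^N`. [folklore] -/
theorem centredBinomial_cexp_sum (N : ℕ) (ξ : Fin 2 → ℝ) :
    ∑ y ∈ Fintype.piFinset (fun _ : Fin 2 => Finset.Icc (-(N : ℤ)) N),
      ((∏ j, ((2 * N).choose (y j + N).toNat : ℝ) : ℝ) : ℂ) * Complex.exp ((phase 2 ξ y : ℝ) * Complex.I) =
      ((∏ j, (2 + 2 * Real.cos (ξ j)) ^ N : ℝ) : ℂ) := by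
  have hfac : ∑ y ∈ Fintype.piFinset (fun _ : Fin 2 => Finset.Icc (-(N : ℤ)) N),
      ((∏ j, ((2 * N).choose (y j + N).toNat : ℝ) : ℝ) : ℂ) * Complex.exp ((phase 2 ξ y : ℝ) * Complex.I) =
      ∏ j : Fin 2, ∑ t ∈ Finset.Icc (-(N : ℤ)) N,
        ((2 * N).choose (t + N).toNat : ℂ) * Complex.exp ((ξ j * t : ℝ) * Complex.I) := by
    rw [Finset.prod_univ_sum]
    refine Finset.sum_congr rfl fun y _ => ?_
    rw [phase, Complex.ofReal_prod]
    push_cast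
    rw [Finset.sum_mul, Complex.exp_sum, ← Finset.prod_mul_distrib]
  rw [hfac]
  simp_rw [sum_Icc_choose_mul_cexp]
  push_cast
  rfl

/-- **Cosine sums against the centred binomial kernel**: for all `ξ, η ∈ ℝ²` and `α ∈ ℝ`,
`∑_{a,b∈s_N} b(a) b(b) cos(ξ·a + η·b + α) = cos α · Π(ξ) Π(η)`, `Π(ξ) = ∏_j (2 + 2cos ξ_j)^N`
(the kernel is real: `∑_y b(y) sin(ξ·y) = 0`). [folklore] -/
theorem centredBinomial_sum_sum_cos (N : ℕ) (ξ η : Fin 2 → ℝ) (α : ℝ) :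
    ∑ a ∈ Fintype.piFinset (fun _ : Fin 2 => Finset.Icc (-(N : ℤ)) N),
      ∑ b ∈ Fintype.piFinset (fun _ : Fin 2 => Finset.Icc (-(N : ℤ)) N),
        (∏ j, ((2 * N).choose (a j + N).toNat : ℝ)) * (∏ j, ((2 * N).choose (b j + N).toNat : ℝ)) *
          Real.cos (phase 2 ξ a + phase 2 η b + α) =
      Real.cos α * ((∏ j, (2 + 2 * Real.cos (ξ j)) ^ N) * ∏ j, (2 + 2 * Real.cos (η j)) ^ N) := by
  set sN := Fintype.piFinset (fun _ : Fin 2 => Finset.Icc (-(N : ℤ)) N) with hsN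
  set bN : (Fin 2 → ℤ) → ℝ := fun y => ∏ j, ((2 * N).choose (y j + N).toNat : ℝ) with hbN
  -- the double sum is the real part of `e^{iα} (∑_a b(a) e^{iξ·a}) (∑_b b(b) e^{iη·b})`
  have hA := centredBinomial_cexp_sum N ξ
  have hB := centredBinomial_cexp_sum N η
  have hprod : Complex.exp ((α : ℝ) * Complex.I) *
      ((∑ a ∈ sN, ((bN a : ℝ) : ℂ) * Complex.exp ((phase 2 ξ a : ℝ) * Complex.I)) *
        ∑ b ∈ sN, ((bN b : ℝ) : ℂ) * Complex.exp ((phase 2 η b : ℝ) * Complex.I)) =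
      ∑ a ∈ sN, ∑ b ∈ sN, ((bN a * bN b : ℝ) : ℂ) *
        Complex.exp (((phase 2 ξ a + phase 2 η b + α : ℝ) : ℂ) * Complex.I) := by
    rw [Finset.sum_mul_sum, Finset.mul_sum]
    refine Finset.sum_congr rfl fun a _ => ?_
    rw [Finset.mul_sum]
    refine Finset.sum_congr rfl fun b _ => ?_
    have : Complex.exp (((phase 2 ξ a + phase 2 η b + α : ℝ) : ℂ) * Complex.I) =
        Complex.exp ((α : ℝ) * Complex.I) * (Complex.exp ((phase 2 ξ a : ℝ) * Complex.I) *
          Complex.exp ((phase 2 η b : ℝ) * Complex.I)) := by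
      rw [← Complex.exp_add, ← Complex.exp_add]; congr 1; push_cast; ring
    rw [this]; push_cast; ring
  have hre := congrArg Complex.re hprod
  rw [hA, hB, Complex.re_sum] at hre
  simp only [Complex.re_sum] at hre
  have hlhs : ∀ a b : Fin 2 → ℤ, (((bN a * bN b : ℝ) : ℂ) *
      Complex.exp (((phase 2 ξ a + phase 2 η b + α : ℝ) : ℂ) * Complex.I)).re =
      bN a * bN b * Real.cos (phase 2 ξ a + phase 2 η b + α) := by
    intro a b
    rw [Complex.re_ofReal_mul, Complex.exp_ofReal_mul_I_re]
  simp only [hlhs] at hre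
  rw [← hre, ← Complex.ofReal_mul, Complex.re_mul_ofReal, Complex.exp_ofReal_mul_I_re]

/-! ### Separated bumps -/

/-- `(2 + 2cos(a + b))(2 + 2cos(a - b)) = 4 (cos a + cos b)²`. [folklore] -/
theorem two_add_two_cos_add_mul_two_add_two_cos_sub (a b : ℝ) :
    (2 + 2 * Real.cos (a + b)) * (2 + 2 * Real.cos (a - b)) = 4 * (Real.cos a + Real.cos b) ^ 2 := by
  rw [Real.cos_add, Real.cos_sub]; nlinarith [Real.sin_sq_add_cos_sq a, Real.sin_sq_add_cos_sq b]

/-- **Two bumps centred at `±κ₀` overlap little**: if `|cos κ₀_{j₀}| ≤ c` (`0 ≤ c`) then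
`Π(k + κ₀) Π(k - κ₀) ≤ 16^N 4^N (1 + c)^{2N}` for all `k ∈ ℝ²`, `Π(ξ) = ∏_j (2 + 2cos ξ_j)^N`. [folklore] -/
theorem prod_bump_add_mul_prod_bump_sub_le (N : ℕ) {κ₀ : Fin 2 → ℝ} {c : ℝ} (hc : 0 ≤ c) {j₀ : Fin 2}
    (hj₀ : |Real.cos (κ₀ j₀)| ≤ c) (k : Fin 2 → ℝ) :
    (∏ j, (2 + 2 * Real.cos ((k + κ₀) j)) ^ N) * (∏ j, (2 + 2 * Real.cos ((k - κ₀) j)) ^ N) ≤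
      16 ^ N * 4 ^ N * (1 + c) ^ (2 * N) := by
  rw [← Finset.prod_mul_distrib]
  have hj : ∀ j, (2 + 2 * Real.cos ((k + κ₀) j)) ^ N * (2 + 2 * Real.cos ((k - κ₀) j)) ^ N =
      4 ^ N * (Real.cos (k j) + Real.cos (κ₀ j)) ^ (2 * N) := by
    intro j
    rw [← mul_pow, Pi.add_apply, Pi.sub_apply, two_add_two_cos_add_mul_two_add_two_cos_sub, mul_pow, pow_mul]
  simp_rw [hj]
  have hgen : ∀ j, (Real.cos (k j) + Real.cos (κ₀ j)) ^ (2 * N) ≤ 2 ^ (2 * N) := fun j => by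
    rw [pow_mul, pow_mul]
    refine pow_le_pow_left₀ (sq_nonneg _) ?_ N
    nlinarith [Real.abs_cos_le_one (k j), Real.abs_cos_le_one (κ₀ j), abs_le.1 (Real.abs_cos_le_one (k j)),
      abs_le.1 (Real.abs_cos_le_one (κ₀ j))]
  have hsp : (Real.cos (k j₀) + Real.cos (κ₀ j₀)) ^ (2 * N) ≤ (1 + c) ^ (2 * N) := by
    rw [pow_mul, pow_mul]
    refine pow_le_pow_left₀ (sq_nonneg _) ?_ N
    nlinarith [abs_le.1 (Real.abs_cos_le_one (k j₀)), abs_le.1 hj₀]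
  have hnn : ∀ j, 0 ≤ 4 ^ N * (Real.cos (k j) + Real.cos (κ₀ j)) ^ (2 * N) := fun j => by
    rw [pow_mul]; positivity
  rw [Fin.prod_univ_two]
  fin_cases j₀
  · calc 4 ^ N * (Real.cos (k 0) + Real.cos (κ₀ 0)) ^ (2 * N) * (4 ^ N * (Real.cos (k 1) + Real.cos (κ₀ 1)) ^ (2 * N))
        ≤ 4 ^ N * (1 + c) ^ (2 * N) * (4 ^ N * 2 ^ (2 * N)) := by
          refine mul_le_mul (mul_le_mul_of_nonneg_left hsp (by positivity))
            (mul_le_mul_of_nonneg_left (hgen 1) (by positivity)) (hnn 1) (by positivity)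
      _ = 16 ^ N * 4 ^ N * (1 + c) ^ (2 * N) := by
          rw [pow_mul (2 : ℝ) 2 N, show (16 : ℝ) ^ N = 4 ^ N * 4 ^ N by rw [← mul_pow]; norm_num]
          norm_num; ring
  · calc 4 ^ N * (Real.cos (k 0) + Real.cos (κ₀ 0)) ^ (2 * N) * (4 ^ N * (Real.cos (k 1) + Real.cos (κ₀ 1)) ^ (2 * N))
        ≤ 4 ^ N * 2 ^ (2 * N) * (4 ^ N * (1 + c) ^ (2 * N)) := by
          refine mul_le_mul (mul_le_mul_of_nonneg_left (hgen 0) (by positivity))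
            (mul_le_mul_of_nonneg_left hsp (by positivity)) (hnn 1) (by positivity)
      _ = 16 ^ N * 4 ^ N * (1 + c) ^ (2 * N) := by
          rw [pow_mul (2 : ℝ) 2 N, show (16 : ℝ) ^ N = 4 ^ N * 4 ^ N by rw [← mul_pow]; norm_num]
          norm_num; ring

/-- **The overlap is negligible against one squared bump**: for `0 ≤ c < 1`,
`(1 + c)^{2N} 2^{2N} / I_{2N}² → 0`, `I_M = ∫_{-π}^{π} (1 + cos t)^M dt` (file `…PickInversionAux13`,
`tendsto_vp_far_sup`, along `M = 2N`). [folklore] -/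
theorem tendsto_overlap_ratio {c : ℝ} (hc0 : 0 ≤ c) (hc1 : c < 1) :
    Tendsto (fun N : ℕ => (1 + c) ^ (2 * N) * 2 ^ (2 * N) /
      (∫ t in (-π)..π, (1 + Real.cos t) ^ (2 * N)) ^ 2) atTop (𝓝 0) := by
  have hcos : Real.cos (Real.arccos c) = c := Real.cos_arccos (by linarith) hc1.le
  have h := tendsto_vp_far_sup (δ := Real.arccos c) (by rw [hcos]; exact hc1)
  rw [hcos] at h; exact h.comp (tendsto_id.const_mul_atTop' two_pos)

/-- The normalisation of one squared bump: `∫_{[-π,π]²} Π(k - κ₀)² dk = 16^N I_{2N}²`. [folklore] -/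
theorem setIntegral_bump_sq (N : ℕ) (κ₀ : Fin 2 → ℝ) :
    ∫ k in Set.pi Set.univ (fun _ : Fin 2 => Set.Icc (-π) π), (∏ j, (2 + 2 * Real.cos ((k - κ₀) j)) ^ N) ^ 2 =
      16 ^ N * (∫ t in (-π)..π, (1 + Real.cos t) ^ (2 * N)) ^ 2 := by
  have h : ∀ k : Fin 2 → ℝ, (∏ j, (2 + 2 * Real.cos ((k - κ₀) j)) ^ N) ^ 2 =
      16 ^ N * ∏ j, (1 + Real.cos (k j - κ₀ j)) ^ (2 * N) := by
    intro k
    have : ∀ j, (2 + 2 * Real.cos ((k - κ₀) j)) ^ N = 2 ^ N * (1 + Real.cos (k j - κ₀ j)) ^ N := fun j => by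
      rw [← mul_pow, Pi.sub_apply]; ring
    simp_rw [this]
    rw [Finset.prod_mul_distrib, Fin.prod_const, mul_pow, ← Finset.prod_pow]
    simp_rw [← pow_mul, show N * 2 = 2 * N from mul_comm _ _]
    congr 1
    rw [show 2 * N * 2 = 4 * N by ring, pow_mul]
    norm_num
  simp_rw [h]
  rw [integral_const_mul, setIntegral_vp_prod]

/-- **Registered auxiliary stub `stub_slabModeExpDecay_auxDiagLineHol3`** (sub-goal of the brick
`stub_slabModeExpDecay_auxDiagLineHol` of `stub_slabModeExpDecay`): the moment criterion on `[-1, 1]`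
(`exists_measure_Icc_neg_one_of_momentLimit`). [folklore] -/
theorem stub_slabModeExpDecay_auxDiagLineHol3 : ∀ (u : ℕ → ℝ) (ν : ℕ → MeasureTheory.Measure ℝ) (M : ℝ), (∀ j, MeasureTheory.IsFiniteMeasure (ν j)) → (∀ j n, MeasureTheory.Integrable (fun x : ℝ => x ^ n) (ν j)) → (∀ j n, n ≤ j → ∫ x, x ^ (2 * n) ∂(ν j) ≤ M) → (∀ n, Filter.Tendsto (fun j => ∫ x, x ^ n ∂(ν j)) Filter.atTop (nhds (u n))) → ∃ μ : MeasureTheory.Measure ℝ, MeasureTheory.IsFiniteMeasure μ ∧ μ (Set.Icc (-1 : ℝ) 1)ᶜ = 0 ∧ ∀ n : ℕ, u n = ∫ t, t ^ n ∂μ :=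
  fun u ν _ hfin hint hle hlim => exists_measure_Icc_neg_one_of_momentLimit u ν hfin hint hle hlim

end Summit.CriticalPhenomena.Ising3DConformalLimit.Cruxes.DirectCorrelationStableTail.SelfEnergyPickInversion

end
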